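import Literature.NumberTheory.LFunctions.RudnickSarnakThm41
import Literature.NumberTheory.LFunctions.RudnickSarnakCube
import Literature.NumberTheory.LFunctions.RudnickSarnakGlue
import Literature.NumberTheory.LFunctions.RudnickSarnakMerge
import Literature.NumberTheory.LFunctions.RudnickSarnakUnique
import HarnessLib

/-!
# Rudnick–Sarnak Theorem 4.1 for `ζ`: the discharge of `rudnick_sarnak_thm41`

Proofs only (no named facts). Z. Rudnick, P. Sarnak, *Zeros of principal `L`-functions and
random matrix theory*, Duke Math. J. **81** (1996), **Theorem 4.1** (p. 307: "for `∑ |u_j| < 2`,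
the Fourier transform `Ŵ_n(u)` is equal to `R_O(u) = ∑_F μ(O, F) C_F(u)`"), in the paired form
recorded by the named fact `rudnick_sarnak_thm41` (`RudnickSarnakThm41.lean`):
`∑_Q μ(O, Q) · ∫ Φ'_Q C_O^{(ν(Q))} = rsLimit k f_Φ` for admissible `Φ` and admissible
representatives `Φ'_Q` of the pull-backs `ι_Q^* f_Φ`. This file assembles the pieces proved in
the tree into `rudnick_sarnak_thm41_holds`; both sides are brought to the common form

  `∑_F ∑_{A ⊆ free(F)} μ(O, F_A) ∫_{H_F} ∏_{C ∈ F, C ∩ A ≠ ∅} |∑_{i ∈ C ∩ A} u_i| Φ(u) du`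

(`F_A = refineBy F A` the refinement of `F` splitting each block `C` into `C ∩ A`, `C ∖ A`;
`H_F = {u : ∑_{i ∈ C} u_i = 0, C ∈ F}` in the coordinates `extG F` of `RudnickSarnakStrata.lean`),
which is "comparing the coefficients of `δ_F(u)` in Propositions 4.1 and 4.2" (p. 308).

* **GUE side** (Prop. 4.2–4.3): `rsLimit k f_Φ = ∑_σ sign σ I_σ(Φ)`
  (`rsLimit_rsPhiTest_eq_sum_cubeFunctional`, (4.27)); `I_σ(Φ) = ∫_{H_G} ∏_C (1 - V_{σ,C})₊ Φ`
  (`cubeFunctional_eq_integral_extG`, Lemmas 4.2–4.3); grouping `σ` by its orbit partition `G`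
  and factorising over the blocks (`sum_fib_eq_prod`; the block factor only sees `σ|_C`,
  `blockFactor_onBlock`); on the support of `Φ` the positive parts are void
  (`two_mul_spreadFn_le`: `2V ≤ ∑ |u_j| < 2`); Proposition 4.3 per block
  (`sum_cyc_sign_mul_one_sub_cycSpread`, Spitzer); and the expansion (4.25) with (4.4)
  (`prod_sum_powerset_eq_sum_powerset_prod`, `partitionMoebius_refineBy`):
  `rsLimit_eq_sum_sum_powerset`.
* **Arithmetic side** (Prop. 4.1, Lemma 4.1): the pairing functional of `Φ'_Q` is that of the
  fibre integral `Φ_Q` (`rsPairingFunctional_eq_fibreIntegral`: (4.14) and uniqueness on the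
  hyperplane); markings of `Q` are admissible coarsenings `F` (`sum_matchings_eq_sum_coarsenings`);
  `(Q, F) ↦ (F, A = demoted F Q)` (`sum_adm_eq_sum_powerset`):
  `sum_partitionMoebius_mul_rsPairingFunctional_eq`; and for each admissible pair the matched
  pairs of labels are the new free indices `NewFree Q F` (`pair_mem_matchOf`, `pair_injective`,
  `pair_surjective`), the substitution `v_p = ±t_j` preserves Lebesgue measure, the fibre point
  over `ζ(t) = ∑_p v_p e_p` is the glued point `extG F (glue Q F t w)` (`fillQ_zeta_eq_extG_glue`),
  and gluing the strata (`integral_extG_eq_integral_integral_glue`) gives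
  `pairTerm_eq_integral_extG`.

## References

* Z. Rudnick, P. Sarnak, Duke Math. J. 81 (1996), 269–322: Thm 4.1 (p. 307), Lemma 4.1,
  (4.13)–(4.16), Props 4.1–4.3, Lemmas 4.2–4.3, (4.18)–(4.43).
* F. Spitzer, Trans. AMS 82 (1956), Thm 2.2.
-/

noncomputable section

open Finset Equiv Equiv.Perm MeasureTheory Complex
open Literature.Combinatorics.Enumerative Literature.Combinatorics.Enumerative.Spitzer
open scoped Real

namespace Literature.NumberTheory.LFunctions

namespace RudnickSarnak

variable {n : ℕ}

/-! ## Continuity of the spread and of the block factors -/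

/-- The prefix sums are continuous in the steps. [folklore] -/
theorem continuous_preSum_apply {ℓ : ℕ} (t : ℕ) : Continuous fun y : Fin ℓ → ℝ ↦ preSum y t := by
  unfold preSum
  exact continuous_finsetSum _ fun i _ ↦ continuous_apply i

/-- `S(y) = max_t s_t(y)` is continuous. [folklore] -/
theorem continuous_maxPre_apply {ℓ : ℕ} : Continuous fun y : Fin ℓ → ℝ ↦ maxPre y := by
  unfold maxPre
  exact Continuous.finset_sup'_apply _ fun t _ ↦ continuous_preSum_apply t

/-- The spread is continuous. [folklore] -/
theorem continuous_spreadFn_apply {ℓ : ℕ} : Continuous fun y : Fin ℓ → ℝ ↦ spreadFn y := by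
  unfold spreadFn
  exact continuous_maxPre_apply.add (continuous_maxPre_apply.comp continuous_neg)

/-- The spread along a cycle is continuous in `u`. [folklore] -/
theorem continuous_cycSpread_apply (τ : Perm (Fin n)) (b : Fin n) (ℓ : ℕ) :
    Continuous fun u : Fin n → ℝ ↦ cycSpread τ b ℓ u := by
  unfold cycSpread
  exact continuous_spreadFn_apply.comp (continuous_pi fun t ↦ continuous_apply _)

/-- The block factor `(1 - V_{σ,C}(u))₊` is continuous in `u`. [folklore] -/
theorem continuous_blockFactor_apply (σ : Perm (Fin n)) (C : Finset (Fin n)) :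
    Continuous fun u : Fin n → ℝ ↦ blockFactor σ u C := by
  unfold blockFactor
  split_ifs with h
  · exact (continuous_const.sub (continuous_cycSpread_apply _ _ _)).max continuous_const
  · exact continuous_const

/-! ## Integrability over a stratum -/

/-- The free coordinates are coordinates of `extG`. [folklore] -/
theorem norm_free_le_norm_extG (G : Finpartition (univ : Finset (Fin n))) (u' : Free G → ℝ) :
    ‖u'‖ ≤ ‖extG G u'‖ := by
  refine (pi_norm_le_iff_of_nonneg (norm_nonneg _)).2 fun j ↦ ?_
  have := norm_le_pi_norm (extG G u') j
  rwa [extG_apply_free] at this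

/-- `Φ ∘ extG` has compact support if `Φ` has. [folklore] -/
theorem hasCompactSupport_testfn_comp_extG (G : Finpartition (univ : Finset (Fin n)))
    {Φ : (Fin n → ℝ) → ℂ} (hΦ : HasCompactSupport Φ) :
    HasCompactSupport fun u' : Free G → ℝ ↦ Φ (extG G u') := by
  obtain ⟨R, hR⟩ := hΦ.isCompact.isBounded.subset_closedBall 0
  refine HasCompactSupport.of_support_subset_isCompact (isCompact_closedBall (0 : Free G → ℝ) R)
    fun u' hu' ↦ ?_
  have hmem := hR (subset_tsupport _ (Function.mem_support.2 hu'))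
  rw [Metric.mem_closedBall, dist_zero_right] at hmem ⊢
  exact (norm_free_le_norm_extG G u').trans hmem

/-- A continuous weight times `Φ ∘ extG` is integrable over the free coordinates. [folklore] -/
theorem integrable_weight_mul_testfn_comp_extG (G : Finpartition (univ : Finset (Fin n))) {Φ : (Fin n → ℝ) → ℂ}
    (hΦc : Continuous Φ) (hΦs : HasCompactSupport Φ) {g : (Free G → ℝ) → ℂ} (hg : Continuous g) :
    Integrable fun u' : Free G → ℝ ↦ g u' * Φ (extG G u') :=
  (hg.mul (hΦc.comp (continuous_extG G))).integrable_of_hasCompactSupport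
    (hasCompactSupport_testfn_comp_extG G hΦs).mul_left

/-! ## The GUE side grouped by orbit partitions -/

/-- The cube functional over the stratum of a prescribed orbit partition. [cite: RudnickSarnak1996, Lemma 4.2] -/
theorem cubeFunctional_eq_integral_extG_of_mem_fib {Φ : (Fin n → ℝ) → ℂ} (hΦ : Continuous Φ)
    {G : Finpartition (univ : Finset (Fin n))} {σ : Perm (Fin n)} (hσ : σ ∈ fib G.parts) :
    cubeFunctional σ Φ = ∫ u' : Free G → ℝ,
      ((∏ C ∈ G.parts, blockFactor σ (extG G u') C : ℝ) : ℂ) * Φ (extG G u') := by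
  obtain rfl := mem_fib_parts_iff.1 hσ
  exact cubeFunctional_eq_integral_extG σ hΦ

/-- `rsLimit k f_Φ = ∑_G ∫_{H_G} (∑_{σ : cyclePart σ = G} sign σ ∏_C (1 - V_{σ,C})₊) Φ`.
[cite: RudnickSarnak1996, (4.27)–(4.28)] -/
theorem rsLimit_eq_sum_cyclePart {k : ℕ} {Φ : (Fin (k + 1) → ℝ) → ℂ} (hΦ : IsRSAdmissiblePhi k Φ)
    (hslice : ∃ g : SchwartzMap (Fin k → ℝ) ℂ, ⇑g = rsSlice (rsPhiTest Φ)) :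
    rsLimit k (rsPhiTest Φ) = ∑ G : Finpartition (univ : Finset (Fin (k + 1))),
      ∫ u' : Free G → ℝ, ((∑ σ ∈ fib G.parts, ((Equiv.Perm.sign σ : ℤ) : ℝ) *
        ∏ C ∈ G.parts, blockFactor σ (extG G u') C : ℝ) : ℂ) * Φ (extG G u') := by
  rw [rsLimit_rsPhiTest_eq_sum_cubeFunctional hΦ hslice,
    sum_perm_eq_sum_cyclePart (fun σ ↦ ((Equiv.Perm.sign σ : ℤ) : ℂ) * cubeFunctional σ Φ)]
  refine Finset.sum_congr rfl fun G _ ↦ ?_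
  have hΦc : Continuous Φ := hΦ.contDiff.continuous
  have hΦs : HasCompactSupport Φ := hΦ.hasCompactSupport
  have hterm : ∀ σ ∈ fib G.parts, ((Equiv.Perm.sign σ : ℤ) : ℂ) * cubeFunctional σ Φ =
      ∫ u' : Free G → ℝ, ((Equiv.Perm.sign σ : ℤ) : ℂ) *
        (((∏ C ∈ G.parts, blockFactor σ (extG G u') C : ℝ) : ℂ) * Φ (extG G u')) := by
    intro σ hσ
    rw [cubeFunctional_eq_integral_extG_of_mem_fib hΦc hσ, integral_const_mul]
  rw [Finset.sum_congr rfl hterm, ← integral_finsetSum]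
  · refine integral_congr_ae (Filter.Eventually.of_forall fun u' ↦ ?_)
    push_cast
    rw [Finset.sum_mul]
    refine Finset.sum_congr rfl fun σ _ ↦ ?_
    ring
  · intro σ _
    refine (integrable_weight_mul_testfn_comp_extG G hΦc hΦs ?_).const_mul _
    exact Complex.continuous_ofReal.comp (continuous_finsetProd _ fun C _ ↦
      (continuous_blockFactor_apply σ C).comp (continuous_extG G))

/-! ## Factorisation over the blocks -/

section onBlock

variable {α : Type*} [Fintype α] [DecidableEq α]

omit [Fintype α] in
/-- A permutation preserves a finite set iff it maps it into itself. [folklore] -/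
theorem preserves_iff_mapsTo (σ : Perm α) (C : Finset α) :
    (∀ x, σ x ∈ C ↔ x ∈ C) ↔ ∀ x ∈ C, σ x ∈ C := by
  constructor
  · exact fun h x hx ↦ (h x).2 hx
  · intro h x
    refine ⟨fun hx ↦ ?_, h x⟩
    have himg : C.image σ = C := Finset.eq_of_subset_of_card_le
      (Finset.image_subset_iff.2 h) (by rw [Finset.card_image_of_injective _ σ.injective])
    rw [← himg] at hx
    obtain ⟨y, hy, hyx⟩ := Finset.mem_image.1 hx
    rwa [← σ.injective hyx]

/-- `onBlock σ C` only depends on `σ|_C`. [folklore] -/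
theorem onBlock_congr {σ σ' : Perm α} {C : Finset α} (h : ∀ x ∈ C, σ x = σ' x) :
    onBlock σ C = onBlock σ' C := by
  by_cases hσ : ∀ x, σ x ∈ C ↔ x ∈ C
  · have hσ' : ∀ x, σ' x ∈ C ↔ x ∈ C := by
      rw [preserves_iff_mapsTo] at hσ ⊢
      intro x hx
      rw [← h x hx]
      exact hσ x hx
    ext x
    by_cases hx : x ∈ C
    · rw [onBlock_apply_of_mem hσ hx, onBlock_apply_of_mem hσ' hx, h x hx]
    · rw [onBlock_apply_of_not_mem hσ hx, onBlock_apply_of_not_mem hσ' hx]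
  · have hσ' : ¬∀ x, σ' x ∈ C ↔ x ∈ C := by
      rw [preserves_iff_mapsTo] at hσ ⊢
      intro h'
      apply hσ
      intro x hx
      rw [h x hx]
      exact h' x hx
    rw [onBlock, dif_neg hσ, onBlock, dif_neg hσ']

/-- A cyclic permutation of `C` is its own restriction to `C`. [folklore] -/
theorem onBlock_eq_self_of_mem_cyc {τ : Perm α} {C : Finset α} (hτ : τ ∈ fib {C}) :
    onBlock τ C = τ := by
  obtain ⟨hC, hfix⟩ := mem_cyc.1 hτ
  have h : ∀ x, τ x ∈ C ↔ x ∈ C := fun x ↦ by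
    have := hC.apply_mem_iff (x := x)
    simpa using this
  ext x
  by_cases hx : x ∈ C
  · rw [onBlock_apply_of_mem h hx]
  · rw [onBlock_apply_of_not_mem h hx, hfix x hx]

end onBlock

/-- The block factor of `C` only sees `σ|_C` (for `σ` preserving `C`). [folklore] -/
theorem blockFactor_onBlock {σ : Perm (Fin n)} {C : Finset (Fin n)}
    (hσC : σ.IsCycleOn (C : Set (Fin n))) (u : Fin n → ℝ) :
    blockFactor (onBlock σ C) u C = blockFactor σ u C := by
  have h : ∀ x, σ x ∈ C ↔ x ∈ C := fun x ↦ by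
    have := hσC.apply_mem_iff (x := x)
    simpa using this
  unfold blockFactor
  split_ifs with hC
  · congr 2
    unfold cycSpread
    congr 1
    funext t
    simp only [Function.comp_apply, orbitSeq]
    have key : ∀ (ρ : Perm (Fin n)) (m : Fin n), (ρ ^ ((t : ℕ) + 1)) (ρ⁻¹ m) = (ρ ^ (t : ℕ)) m := by
      intro ρ m
      rw [pow_succ, Perm.mul_apply]
      simp
    rw [key, key]
    congr 1
    exact (pow_apply_eq_of_eqOn (σ := onBlock σ C) (τ := σ) (fun x hx ↦ IsCycleOn.apply_mem' hσC hx)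
      (fun x hx ↦ onBlock_apply_of_mem h hx) t (C.min'_mem hC)).1
  · rfl

/-- **Factorisation over the blocks**:
`∑_{σ ∈ fib G} sign σ ∏_C (1 - V_{σ,C})₊ = ∏_C ∑_{τ ∈ S*(C)} sign τ (1 - V_{τ,C})₊`.
[cite: RudnickSarnak1996, proof of Prop 4.2] -/
theorem sum_fib_sign_prod_blockFactor (G : Finpartition (univ : Finset (Fin n))) (u : Fin n → ℝ) :
    ∑ σ ∈ fib G.parts, ((Equiv.Perm.sign σ : ℤ) : ℝ) * ∏ C ∈ G.parts, blockFactor σ u C =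
      ∏ C ∈ G.parts, ∑ τ ∈ fib {C}, ((Equiv.Perm.sign τ : ℤ) : ℝ) * blockFactor τ u C := by
  have h1 : ∀ σ ∈ fib G.parts,
      ∏ C ∈ G.parts, blockFactor σ u C = ∏ C ∈ G.parts, blockFactor (onBlock σ C) u C := by
    intro σ hσ
    refine Finset.prod_congr rfl fun C hC ↦ ?_
    rw [blockFactor_onBlock ((mem_fib.1 hσ).1 C hC)]
  rw [Finset.sum_congr rfl (fun σ hσ ↦ by rw [h1 σ hσ]),
    sum_fib_eq_prod (R := ℝ) G.parts G.supIndep.pairwiseDisjoint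
      (fun C σ ↦ blockFactor (onBlock σ C) u C) (fun C _ σ σ' h ↦ by simp only [onBlock_congr h])]
  refine Finset.prod_congr rfl fun C _ ↦ Finset.sum_congr rfl fun τ hτ ↦ ?_
  rw [onBlock_eq_self_of_mem_cyc hτ]

/-! ## The spread is at most `½ ∑ |u_j|` -/

section spreadBound

variable {N : ℕ} (y : Fin N → ℝ)

/-- `s_t = -∑_{i ≥ t} y_i` for zero-sum steps. [folklore] -/
theorem preSum_eq_neg_sum_filter_not (hy : ∑ i, y i = 0) (t : ℕ) :
    preSum y t = -∑ i ∈ univ.filter (fun i : Fin N ↦ ¬(i : ℕ) < t), y i := by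
  unfold preSum
  have := Finset.sum_filter_add_sum_filter_not univ (fun i : Fin N ↦ (i : ℕ) < t) y
  rw [hy] at this
  linarith

/-- `s_{t₂} - s_{t₁} = ∑_{t₁ ≤ i < t₂} y_i`. [folklore] -/
theorem preSum_sub_preSum {t₁ t₂ : ℕ} (h : t₁ ≤ t₂) :
    preSum y t₂ - preSum y t₁ =
      ∑ i ∈ univ.filter (fun i : Fin N ↦ t₁ ≤ (i : ℕ) ∧ (i : ℕ) < t₂), y i := by
  unfold preSum
  rw [sub_eq_iff_eq_add', ← Finset.sum_union]
  · congr 1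
    ext i
    simp only [Finset.mem_union, Finset.mem_filter, Finset.mem_univ, true_and]
    omega
  · rw [Finset.disjoint_filter]
    intro i _ h1 h2
    omega

/-- `∑_{i < t₁} |y_i| + ∑_{t₁ ≤ i < t₂} |y_i| + ∑_{i ≥ t₂} |y_i| = ∑ |y_i|`. [folklore] -/
theorem sum_abs_split {t₁ t₂ : ℕ} (h : t₁ ≤ t₂) :
    ∑ i ∈ univ.filter (fun i : Fin N ↦ (i : ℕ) < t₁), |y i| +
      ∑ i ∈ univ.filter (fun i : Fin N ↦ t₁ ≤ (i : ℕ) ∧ (i : ℕ) < t₂), |y i| +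
      ∑ i ∈ univ.filter (fun i : Fin N ↦ ¬(i : ℕ) < t₂), |y i| = ∑ i, |y i| := by
  rw [← Finset.sum_union, ← Finset.sum_union]
  · congr 1
    ext i
    simp only [Finset.mem_union, Finset.mem_filter, Finset.mem_univ, true_and, iff_true]
    omega
  · rw [Finset.disjoint_union_left]
    constructor <;> (rw [Finset.disjoint_filter]; intro i _ h1 h2; omega)
  · rw [Finset.disjoint_filter]
    intro i _ h1 h2
    omega

/-- **`2 V ≤ ∑ |y_i|`** for a zero-sum walk: the spread `V = max_t s_t - min_t s_t` is at most
half the total variation. [cite: RudnickSarnak1996, Lemma 4.3] -/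
theorem two_mul_spreadFn_le (hy : ∑ i, y i = 0) : 2 * spreadFn y ≤ ∑ i, |y i| := by
  obtain ⟨p, -, hpeq⟩ := Finset.exists_mem_eq_sup' (s := range (N + 1)) ⟨0, by simp⟩ (preSum y)
  obtain ⟨q, -, hqeq⟩ := Finset.exists_mem_eq_sup' (s := range (N + 1)) ⟨0, by simp⟩ (preSum (-y))
  have hneg : preSum (-y) q = -preSum y q := by simp [preSum, Finset.sum_neg_distrib]
  have hV : spreadFn y = preSum y p - preSum y q := by
    rw [spreadFn, maxPre, maxPre, hpeq, hqeq, hneg]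
    ring
  have hA : ∀ t, preSum y t ≤ ∑ i ∈ univ.filter (fun i : Fin N ↦ (i : ℕ) < t), |y i| ∧
      -preSum y t ≤ ∑ i ∈ univ.filter (fun i : Fin N ↦ (i : ℕ) < t), |y i| := fun t ↦ by
    unfold preSum
    exact ⟨Finset.sum_le_sum fun i _ ↦ le_abs_self _,
      by rw [← Finset.sum_neg_distrib]; exact Finset.sum_le_sum fun i _ ↦ neg_le_abs _⟩
  have hB : ∀ t, preSum y t ≤ ∑ i ∈ univ.filter (fun i : Fin N ↦ ¬(i : ℕ) < t), |y i| ∧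
      -preSum y t ≤ ∑ i ∈ univ.filter (fun i : Fin N ↦ ¬(i : ℕ) < t), |y i| := fun t ↦ by
    rw [preSum_eq_neg_sum_filter_not y hy t, neg_neg]
    exact ⟨by rw [← Finset.sum_neg_distrib]; exact Finset.sum_le_sum fun i _ ↦ neg_le_abs _,
      Finset.sum_le_sum fun i _ ↦ le_abs_self _⟩
  have hM : ∀ t₁ t₂, t₁ ≤ t₂ →
      preSum y t₂ - preSum y t₁ ≤ ∑ i ∈ univ.filter (fun i : Fin N ↦ t₁ ≤ (i : ℕ) ∧ (i : ℕ) < t₂), |y i| ∧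
      preSum y t₁ - preSum y t₂ ≤ ∑ i ∈ univ.filter (fun i : Fin N ↦ t₁ ≤ (i : ℕ) ∧ (i : ℕ) < t₂), |y i| := by
    intro t₁ t₂ h
    rw [show preSum y t₁ - preSum y t₂ = -(preSum y t₂ - preSum y t₁) by ring, preSum_sub_preSum y h]
    exact ⟨Finset.sum_le_sum fun i _ ↦ le_abs_self _,
      by rw [← Finset.sum_neg_distrib]; exact Finset.sum_le_sum fun i _ ↦ neg_le_abs _⟩
  rw [hV]
  rcases le_total p q with hpq | hqp
  · rw [← sum_abs_split y hpq]
    linarith [(hA p).1, (hM p q hpq).2, (hB q).2]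
  · rw [← sum_abs_split y hqp]
    linarith [(hA q).2, (hM q p hqp).1, (hB p).1]

end spreadBound

/-- **`V_τ(u) ≤ 1` on `∑ |u_j| ≤ 2`** (so that the positive part in Lemma 4.3 is void on the
support of `Φ`). [cite: RudnickSarnak1996, Lemma 4.3] -/
theorem cycSpread_le_one {C : Finset (Fin n)} {ℓ : ℕ} (hC : #C = ℓ + 1) {τ : Perm (Fin n)}
    (hτ : τ ∈ fib {C}) {a : Fin n} (ha : a ∈ C) (u : Fin n → ℝ) (hu : ∑ c ∈ C, u c = 0)
    (hu2 : ∑ j, |u j| ≤ 2) : cycSpread τ a (ℓ + 1) u ≤ 1 := by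
  unfold cycSpread
  have he := orbitSeq_mem_linOrders hC hτ ha
  have h0 : ∑ t, (u ∘ orbitSeq τ a (ℓ + 1)) t = 0 := by
    simp only [Function.comp_apply]
    rw [sum_comp_of_mem_linOrders hC he u, hu]
  have h1 : ∑ t, |(u ∘ orbitSeq τ a (ℓ + 1)) t| ≤ 2 := by
    simp only [Function.comp_apply]
    rw [sum_comp_of_mem_linOrders hC he (fun c ↦ |u c|)]
    exact (Finset.sum_le_sum_of_subset_of_nonneg (Finset.subset_univ C)
      (fun _ _ _ ↦ abs_nonneg _)).trans hu2
  have := two_mul_spreadFn_le _ h0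
  linarith

/-- **The signed sum of the block factors over `S*(C)`** on `∑ |u_j| ≤ 2`: Proposition 4.3 per
block (`sum_cyc_sign_mul_one_sub_cycSpread`) with the positive parts removed.
[cite: RudnickSarnak1996, Prop 4.3 and Lemma 4.3] -/
theorem sum_cyc_sign_mul_blockFactor_of_sum_abs_le {C : Finset (Fin n)} {ℓ : ℕ} (hC : #C = ℓ + 1)
    (hne : C.Nonempty) (u : Fin n → ℝ) (hu : ∑ c ∈ C, u c = 0) (hu2 : ∑ j, |u j| ≤ 2) :
    ∑ τ ∈ fib {C}, ((Equiv.Perm.sign τ : ℤ) : ℝ) * blockFactor τ u C =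
      (blockMoebius C : ℝ) + ∑ A ∈ (C.erase (C.min' hne)).powerset with A.Nonempty,
        ((blockMoebius A * blockMoebius (C \ A) : ℤ) : ℝ) * |∑ i ∈ A, u i| := by
  rw [← sum_cyc_sign_mul_one_sub_cycSpread hC (Finset.min'_mem C hne) u hu]
  refine Finset.sum_congr rfl fun τ hτ ↦ ?_
  congr 1
  rw [blockFactor, dif_pos hne, hC]
  have hτ' := mem_cyc.1 hτ
  have hinv : τ⁻¹ (C.min' hne) ∈ C :=
    IsCycleOn.apply_mem' (isCycleOn_inv.2 hτ'.1) (Finset.min'_mem C hne)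
  rw [cycSpread_eq_of_mem hC hτ (Finset.min'_mem C hne) hinv u hu]
  exact max_eq_left (by linarith [cycSpread_le_one hC hτ (Finset.min'_mem C hne) u hu hu2])

/-- For a block `C` of `G`, `C ∖ {min C}` is the free part of `C`. [folklore] -/
theorem erase_min'_eq_inter_freeSet (G : Finpartition (univ : Finset (Fin n))) {C : Finset (Fin n)}
    (hC : C ∈ G.parts) (hne : C.Nonempty) : C.erase (C.min' hne) = C ∩ freeSet G := by
  have hrep : ∀ x ∈ C, rep G x = C.min' hne := by
    intro x hxC
    unfold rep
    congr 1
    exact G.part_eq_of_mem hC hxC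
  ext x
  rw [Finset.mem_erase, Finset.mem_inter, mem_freeSet]
  constructor
  · rintro ⟨hx, hxC⟩
    refine ⟨hxC, fun h ↦ hx ?_⟩
    rw [← hrep x hxC]
    exact h.symm
  · rintro ⟨hxC, hx⟩
    refine ⟨fun h ↦ hx ?_, hxC⟩
    change rep G x = x
    rw [hrep x hxC, h]

/-- **The GUE density on a stratum** (`∑ |u_j| ≤ 2`, block sums zero):
`∑_{σ ∈ fib G} sign σ ∏_C (1 - V_{σ,C}(u))₊ = ∑_{A ⊆ free(G)} μ(O, G_A) ∏_{C ∩ A ≠ ∅} |u_{C ∩ A}|`,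
i.e. Proposition 4.3 on every block followed by the expansion (4.25) and (4.4).
[cite: RudnickSarnak1996, Props 4.2–4.3, (4.25)] -/
theorem sum_fib_sign_prod_blockFactor_eq_sum_powerset (G : Finpartition (univ : Finset (Fin n))) (u : Fin n → ℝ)
    (hu : ∀ j, ∑ i ∈ G.part j, u i = 0) (hu2 : ∑ j, |u j| ≤ 2) :
    ∑ σ ∈ fib G.parts, ((Equiv.Perm.sign σ : ℤ) : ℝ) * ∏ C ∈ G.parts, blockFactor σ u C =
      ∑ A ∈ (freeSet G).powerset, (partitionMoebius (refineBy G A) : ℝ) *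
        ∏ C ∈ G.parts with (C ∩ A).Nonempty, |∑ i ∈ C ∩ A, u i| := by
  rw [sum_fib_sign_prod_blockFactor]
  set φ : Finset (Fin n) → Finset (Fin n) → ℝ := fun C B ↦
    if B = ∅ then (blockMoebius C : ℝ)
      else ((blockMoebius B * blockMoebius (C \ B) : ℤ) : ℝ) * |∑ i ∈ B, u i| with hφ
  have hblock : ∀ C ∈ G.parts, ∑ τ ∈ fib {C}, ((Equiv.Perm.sign τ : ℤ) : ℝ) * blockFactor τ u C =
      ∑ B ∈ (C ∩ freeSet G).powerset, φ C B := by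
    intro C hC
    have hne : C.Nonempty := G.nonempty_of_mem_parts hC
    have hcard : #C = (#C - 1) + 1 := (Nat.succ_pred_eq_of_pos (Finset.card_pos.2 hne)).symm
    obtain ⟨a, ha⟩ := hne
    have hCa : G.part a = C := G.part_eq_of_mem hC ha
    have hu' : ∑ c ∈ C, u c = 0 := by rw [← hCa]; exact hu a
    rw [sum_cyc_sign_mul_blockFactor_of_sum_abs_le hcard ⟨a, ha⟩ u hu' hu2, erase_min'_eq_inter_freeSet G hC,
      ← Finset.sum_filter_add_sum_filter_not (C ∩ freeSet G).powerset (fun B ↦ B.Nonempty) (φ C)]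
    conv_rhs => rw [add_comm]
    congr 1
    · have : (C ∩ freeSet G).powerset.filter (fun B ↦ ¬B.Nonempty) = {∅} := by
        ext B
        simp only [Finset.mem_filter, Finset.mem_powerset, Finset.not_nonempty_iff_eq_empty,
          Finset.mem_singleton]
        exact ⟨fun h ↦ h.2, fun h ↦ ⟨h ▸ Finset.empty_subset _, h⟩⟩
      rw [this, Finset.sum_singleton, hφ]
      simp
    · refine Finset.sum_congr rfl fun B hB ↦ ?_
      obtain ⟨-, hBne⟩ := Finset.mem_filter.1 hB
      simp only [hφ, if_neg hBne.ne_empty]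
  rw [Finset.prod_congr rfl hblock, prod_sum_powerset_eq_sum_powerset_prod G φ]
  refine Finset.sum_congr rfl fun A hA ↦ ?_
  have hA' : A ⊆ freeSet G := Finset.mem_powerset.1 hA
  rw [partitionMoebius_refineBy G hA', Int.cast_prod, Finset.prod_filter, ← Finset.prod_mul_distrib]
  refine Finset.prod_congr rfl fun C _ ↦ ?_
  rw [Finset.inter_comm A C]
  by_cases h : C ∩ A = ∅
  · have hn : ¬(C ∩ A).Nonempty := Finset.not_nonempty_iff_eq_empty.2 h
    simp only [hφ, h, if_true, Finset.not_nonempty_empty, if_false, mul_one]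
  · have hn : (C ∩ A).Nonempty := Finset.nonempty_iff_ne_empty.2 h
    have hsd : C \ (C ∩ A) = C \ A := by
      ext x
      simp only [Finset.mem_sdiff, Finset.mem_inter, not_and]
      tauto
    simp only [hφ, h, if_false, hn, if_true, hsd]

/-- **The GUE side of Theorem 4.1 in sieved form**:
`rsLimit k f_Φ = ∑_G ∑_{A ⊆ free(G)} μ(O, G_A) ∫_{H_G} ∏_{C ∩ A ≠ ∅} |u_{C∩A}| Φ(u) du`.
[cite: RudnickSarnak1996, Thm 4.1 (proof, pp. 309–316)] -/
theorem rsLimit_eq_sum_sum_powerset {k : ℕ} {Φ : (Fin (k + 1) → ℝ) → ℂ} (hΦ : IsRSAdmissiblePhi k Φ)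
    (hslice : ∃ g : SchwartzMap (Fin k → ℝ) ℂ, ⇑g = rsSlice (rsPhiTest Φ)) :
    rsLimit k (rsPhiTest Φ) = ∑ G : Finpartition (univ : Finset (Fin (k + 1))),
      ∑ A ∈ (freeSet G).powerset, (partitionMoebius (refineBy G A) : ℂ) *
        ∫ u' : Free G → ℝ, ((∏ C ∈ G.parts with (C ∩ A).Nonempty,
          |∑ i ∈ C ∩ A, extG G u' i| : ℝ) : ℂ) * Φ (extG G u') := by
  rw [rsLimit_eq_sum_cyclePart hΦ hslice]
  have hΦc : Continuous Φ := hΦ.contDiff.continuous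
  have hΦs : HasCompactSupport Φ := hΦ.hasCompactSupport
  obtain ⟨δ, hδ, hsupp⟩ := hΦ.support_subset
  refine Finset.sum_congr rfl fun G _ ↦ ?_
  have hpt : ∀ u' : Free G → ℝ,
      ((∑ σ ∈ fib G.parts, ((Equiv.Perm.sign σ : ℤ) : ℝ) *
          ∏ C ∈ G.parts, blockFactor σ (extG G u') C : ℝ) : ℂ) * Φ (extG G u') =
        ∑ A ∈ (freeSet G).powerset, (partitionMoebius (refineBy G A) : ℂ) *
          (((∏ C ∈ G.parts with (C ∩ A).Nonempty, |∑ i ∈ C ∩ A, extG G u' i| : ℝ) : ℂ) *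
            Φ (extG G u')) := by
    intro u'
    by_cases h0 : Φ (extG G u') = 0
    · simp [h0]
    · have hu2 : ∑ j, |extG G u' j| ≤ 2 := by
        by_contra hlt
        exact h0 (hsupp _ (by linarith))
      rw [sum_fib_sign_prod_blockFactor_eq_sum_powerset G _ (sum_part_extG G u') hu2]
      push_cast
      rw [Finset.sum_mul]
      refine Finset.sum_congr rfl fun A _ ↦ ?_
      ring
  have hfun : (fun u' : Free G → ℝ ↦ ((∑ σ ∈ fib G.parts, ((Equiv.Perm.sign σ : ℤ) : ℝ) *
      ∏ C ∈ G.parts, blockFactor σ (extG G u') C : ℝ) : ℂ) * Φ (extG G u')) =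
      fun u' ↦ ∑ A ∈ (freeSet G).powerset, (partitionMoebius (refineBy G A) : ℂ) *
        (((∏ C ∈ G.parts with (C ∩ A).Nonempty, |∑ i ∈ C ∩ A, extG G u' i| : ℝ) : ℂ) *
          Φ (extG G u')) := funext hpt
  rw [hfun, integral_finsetSum]
  · refine Finset.sum_congr rfl fun A _ ↦ ?_
    rw [integral_const_mul]
  · intro A _
    refine (integrable_weight_mul_testfn_comp_extG G hΦc hΦs ?_).const_mul _
    exact Complex.continuous_ofReal.comp (continuous_finsetProd _ fun C _ ↦
      (continuous_abs.comp (continuous_finsetSum _ fun i _ ↦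
        (continuous_apply i).comp (continuous_extG G))))

/-! ## The arithmetic side: representatives, fibre integrals, coarsenings -/

/-- `∑_b (e_i - e_j)_b = 0`. [folklore] -/
theorem sum_rsBasisDiff {m : ℕ} (p : Fin m × Fin m) : ∑ b, rsBasisDiff p b = 0 := by
  simp [rsBasisDiff, Finset.sum_sub_distrib]

/-- The arguments `∑_p v_p e_{i(p) j(p)}` of the pairing functional lie on the hyperplane
`∑ ζ_b = 0`. [cite: RudnickSarnak1996, (3.9)–(3.10)] -/
theorem sum_apply_sum_smul_rsBasisDiff {m : ℕ} {ι' : Type*} [Fintype ι'] (v : ι' → ℝ)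
    (e : ι' → Fin m × Fin m) : ∑ b, (∑ p, v p • rsBasisDiff (e p)) b = 0 := by
  simp_rw [Finset.sum_apply, Pi.smul_apply, smul_eq_mul]
  rw [Finset.sum_comm]
  simp [← Finset.mul_sum, sum_rsBasisDiff]

/-- Labels of `blockIdxSucc` agree iff the blocks do. [folklore] -/
theorem blockIdxSucc_eq_iff (Q : Finpartition (univ : Finset (Fin (n + 1)))) {a b : Fin (n + 1)} :
    blockIdxSucc Q a = blockIdxSucc Q b ↔ Q.part a = Q.part b := by
  unfold blockIdxSucc
  rw [(Fin.cast_injective _).eq_iff, blockIdx_eq_blockIdx_iff]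

/-- **Independence of the representative** (RS (4.14) with Fourier inversion on the
hyperplane): the pairing functional (3.9) of any admissible `Φ'` with `f_{Φ'} = ι_Q^* f_Φ` equals
that of the fibre integral `Φ_Q`, because both are continuous, compactly supported, have the
same test function, and (3.9) only evaluates them on `∑ ζ_b = 0`.
[cite: RudnickSarnak1996, (4.14) and Lemma 4.1] -/
theorem rsPairingFunctional_eq_fibreIntegral {k : ℕ} {Φ : (Fin (k + 1) → ℝ) → ℂ}
    (hΦ : IsRSAdmissiblePhi k Φ) (hTF : IsRSTestFunction k (rsPhiTest Φ))
    (Q : Finpartition (univ : Finset (Fin (k + 1))))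
    {Φ' : (Fin (#Q.parts - 1 + 1) → ℝ) → ℂ} (hΦ' : IsRSAdmissiblePhi (#Q.parts - 1) Φ')
    (heq : rsPhiTest Φ' = fun z ↦ rsPhiTest Φ (fun a ↦ z (blockIdxSucc Q a))) :
    rsPairingFunctional (#Q.parts - 1 + 1) Φ' =
      rsPairingFunctional (#Q.parts - 1 + 1) (fibreIntegral Q (blockIdxSucc Q) Φ) := by
  have hΦc : Continuous Φ := hΦ.contDiff.continuous
  have hΦs : HasCompactSupport Φ := hΦ.hasCompactSupport
  have hι : ∀ a b, blockIdxSucc Q a = blockIdxSucc Q b ↔ Q.part a = Q.part b :=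
    fun a b ↦ blockIdxSucc_eq_iff Q
  have hιs := blockIdxSucc_surjective Q
  have heq' : rsPhiTest Φ' = rsPhiTest (fibreIntegral Q (blockIdxSucc Q) Φ) := by
    rw [heq]
    funext z
    exact (rsPhiTest_fibreIntegral Q (blockIdxSucc Q) hι hιs hΦc hΦs z).symm
  have hslice : ∃ g : SchwartzMap (Fin (#Q.parts - 1) → ℝ) ℂ, ⇑g = rsSlice (rsPhiTest Φ') := by
    rw [heq]
    exact exists_schwartz_pulledSlice (rsPhiTest_add_const Φ) hTF.schwartz_slice hιs
  unfold rsPairingFunctional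
  refine Finset.sum_congr rfl fun M _ ↦ integral_congr_ae (Filter.Eventually.of_forall fun v ↦ ?_)
  dsimp only
  congr 1
  exact eq_of_rsPhiTest_eq_of_sum_eq_zero hΦ'.contDiff.continuous hΦ'.hasCompactSupport
    (continuous_fibreIntegral Q _ hΦc hΦs) (hasCompactSupport_fibreIntegral Q _ hι hιs hΦs) heq'
    hslice (sum_apply_sum_smul_rsBasisDiff _ _)

/-- **Markings as coarsenings**: the pairing functional of `Φ_Q` is the sum, over the admissible
coarsenings `F` of `Q`, of the *pair terms* `∫ ∏_p |v_p| Φ_Q(∑_p v_p e_p) dv` over the matched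
pairs `p` of labels. [cite: RudnickSarnak1996, proof of Prop 4.1] -/
theorem rsPairingFunctional_fibreIntegral_eq_sum {k : ℕ} (Φ : (Fin (k + 1) → ℝ) → ℂ)
    (Q : Finpartition (univ : Finset (Fin (k + 1)))) :
    rsPairingFunctional (#Q.parts - 1 + 1) (fibreIntegral Q (blockIdxSucc Q) Φ) =
      ∑ F ∈ (univ : Finset (Finpartition (univ : Finset (Fin (k + 1))))).filter (fun F ↦ Q ∈ Adm F),
        ∫ v : (matchOf Q (blockIdxSucc Q) F) → ℝ, ((∏ p, |v p| : ℝ) : ℂ) *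
          fibreIntegral Q (blockIdxSucc Q) Φ
            (∑ p, v p • rsBasisDiff (p : Fin (#Q.parts - 1 + 1) × Fin (#Q.parts - 1 + 1))) := by
  classical
  have hι : ∀ a b, blockIdxSucc Q a = blockIdxSucc Q b ↔ Q.part a = Q.part b :=
    fun a b ↦ blockIdxSucc_eq_iff Q
  have hιs := blockIdxSucc_surjective Q
  unfold rsPairingFunctional
  exact sum_matchings_eq_sum_coarsenings Q (blockIdxSucc Q) hι hιs (fun _ M ↦
    ∫ v : M → ℝ, ((∏ p, |v p| : ℝ) : ℂ) * fibreIntegral Q (blockIdxSucc Q) Φ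
      (∑ p : M, v p • rsBasisDiff (p : Fin (#Q.parts - 1 + 1) × Fin (#Q.parts - 1 + 1))))

/-- **The arithmetic side regrouped by coarsenings**: with admissible representatives `Φ'_Q`,
`∑_Q μ(O,Q) ∫ Φ'_Q C_O = ∑_F ∑_{A ⊆ free(F)} μ(O, F_A) · (pair term of (F_A, F))`.
[cite: RudnickSarnak1996, proof of Prop 4.1, (4.23)–(4.25)] -/
theorem sum_partitionMoebius_mul_rsPairingFunctional_eq {k : ℕ} {Φ : (Fin (k + 1) → ℝ) → ℂ}
    (hΦ : IsRSAdmissiblePhi k Φ) (hTF : IsRSTestFunction k (rsPhiTest Φ))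
    (Φ' : (Q : Finpartition (univ : Finset (Fin (k + 1)))) → (Fin (#Q.parts - 1 + 1) → ℝ) → ℂ)
    (hadm : ∀ Q, IsRSAdmissiblePhi (#Q.parts - 1) (Φ' Q))
    (heq : ∀ Q, rsPhiTest (Φ' Q) = fun z ↦ rsPhiTest Φ (fun a ↦ z (blockIdxSucc Q a))) :
    ∑ Q, (partitionMoebius Q : ℂ) * rsPairingFunctional (#Q.parts - 1 + 1) (Φ' Q) =
      ∑ F : Finpartition (univ : Finset (Fin (k + 1))), ∑ A ∈ (freeSet F).powerset,
        (partitionMoebius (refineBy F A) : ℂ) *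
          ∫ v : (matchOf (refineBy F A) (blockIdxSucc (refineBy F A)) F) → ℝ, ((∏ p, |v p| : ℝ) : ℂ) *
            fibreIntegral (refineBy F A) (blockIdxSucc (refineBy F A)) Φ
              (∑ p, v p • rsBasisDiff (p : Fin (#(refineBy F A).parts - 1 + 1) × Fin (#(refineBy F A).parts - 1 + 1))) := by
  classical
  -- the pair term of `(Q, F)`
  set I : Finpartition (univ : Finset (Fin (k + 1))) → Finpartition (univ : Finset (Fin (k + 1))) → ℂ :=
    fun Q F ↦ ∫ v : (matchOf Q (blockIdxSucc Q) F) → ℝ, ((∏ p, |v p| : ℝ) : ℂ) *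
        fibreIntegral Q (blockIdxSucc Q) Φ
          (∑ p, v p • rsBasisDiff (p : Fin (#Q.parts - 1 + 1) × Fin (#Q.parts - 1 + 1))) with hI
  have h1 : ∀ Q : Finpartition (univ : Finset (Fin (k + 1))),
      (partitionMoebius Q : ℂ) * rsPairingFunctional (#Q.parts - 1 + 1) (Φ' Q) =
        ∑ F, if Q ∈ Adm F then (partitionMoebius Q : ℂ) * I Q F else 0 := by
    intro Q
    rw [rsPairingFunctional_eq_fibreIntegral hΦ hTF Q (hadm Q) (heq Q),
      rsPairingFunctional_fibreIntegral_eq_sum, Finset.mul_sum, Finset.sum_filter]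
  rw [Finset.sum_congr rfl (fun Q _ ↦ h1 Q), Finset.sum_comm]
  refine Finset.sum_congr rfl fun F _ ↦ ?_
  rw [← Finset.sum_filter]
  have hfil : (univ : Finset (Finpartition (univ : Finset (Fin (k + 1))))).filter (· ∈ Adm F) = Adm F := by
    ext Q
    simp
  rw [hfil]
  exact sum_adm_eq_sum_powerset F (fun Q ↦ (partitionMoebius Q : ℂ) * I Q F)

/-! ## The pair term of an admissible pair `(Q, F)` as an integral over `H_F`

For `Q ∈ Adm F` (every block of `F` the union of at most two blocks of `Q`), with
`D = demoted F Q` the elements whose `Q`-block lost the least element of their `F`-block, the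
matched pairs of labels `matchOf Q ι F` correspond to the *new free* indices
`j ∈ NewFree Q F` (representatives of `Q` that are not representatives of `F`): the pair of
`j` consists of the labels of `j` and of `rep F j`. Substituting accordingly in the pair term
and gluing the fibres of `Q` over the new block sums (`RudnickSarnakGlue.lean`) gives
`pair term = ∫_{H_F} ∏_{C ∩ D ≠ ∅} |u_{C ∩ D}| Φ(u) du` (RS Lemma 4.1 / (4.13) made explicit).
The pair of `j`, its orientation sign and the vector `ζ(t)` of new block sums read on the
labels (`+t_j` at the label of `j`, `-t_j` at the label of `rep F j`) are written out in the
statements below.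
-/

section key

variable {k : ℕ} {F Q : Finpartition (univ : Finset (Fin (k + 1)))}

/-- Sums over an `F`-block are sums over the `Q`-blocks inside it, indexed by their
representatives (for `Q` refining `F`). [folklore] -/
theorem sum_part_eq_sum_filter_isRep (hQF : ∀ a, Q.part a ⊆ F.part a) (g : Fin (k + 1) → ℝ)
    (a : Fin (k + 1)) :
    ∑ i ∈ F.part a, g i = ∑ q ∈ (F.part a).filter (IsRep Q), ∑ i ∈ Q.part q, g i := by
  have hFa : F.part a ∈ F.parts := F.part_mem.2 (mem_univ a)
  rw [← Finset.sum_fiberwise_of_maps_to (s := F.part a) (t := (F.part a).filter (IsRep Q))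
    (g := rep Q) (fun i hi ↦ Finset.mem_filter.2 ⟨?_, isRep_rep Q i⟩) g]
  · refine Finset.sum_congr rfl fun q hq ↦ Finset.sum_congr ?_ fun _ _ ↦ rfl
    obtain ⟨hqC, hqrep⟩ := Finset.mem_filter.1 hq
    have hFq : F.part q = F.part a := F.part_eq_of_mem hFa hqC
    ext i
    rw [Finset.mem_filter, mem_part_iff_rep_eq Q hqrep]
    constructor
    · exact fun h ↦ h.2
    · intro h
      refine ⟨?_, h⟩
      have hi : i ∈ Q.part q := (mem_part_iff_rep_eq Q hqrep).2 h
      have := hQF q hi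
      rwa [hFq] at this
  · have hFi : F.part i = F.part a := F.part_eq_of_mem hFa hi
    have := hQF i (rep_mem Q i)
    rwa [hFi] at this

/-- Labels of `Q`-representatives agree iff the representatives do. [folklore] -/
theorem blockIdxSucc_eq_iff_of_isRep {i j : Fin (k + 1)} (hi : IsRep Q i) (hj : IsRep Q j) :
    blockIdxSucc Q i = blockIdxSucc Q j ↔ i = j := by
  have hi' : rep Q i = i := hi
  have hj' : rep Q j = j := hj
  rw [blockIdxSucc_eq_iff, part_eq_part_iff_rep_eq Q, hi', hj']

/-- The label of the `Q`-representative of `x` is the label of `x`. [folklore] -/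
theorem blockIdxSucc_rep (x : Fin (k + 1)) : blockIdxSucc Q (rep Q x) = blockIdxSucc Q x :=
  (blockIdxSucc_eq_iff Q).2 (part_rep Q x)

/-- A new free index is demoted. [folklore] -/
theorem mem_demoted_of_newFree (j : NewFree Q F) : j.1 ∈ demoted F Q := by
  rw [mem_demoted]
  intro h
  exact j.2.2 (show rep F j.1 = j.1 by rw [← h]; exact j.2.1)

/-- The orientation sign of the pair of a new free index has absolute value `1`. [folklore] -/
theorem abs_pairSignIte (j : NewFree Q F) :
    |(if blockIdxSucc Q j.1 < blockIdxSucc Q (rep F j.1) then (1 : ℝ) else -1)| = 1 := by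
  split_ifs <;> norm_num

/-- The orientation sign is nonzero. [folklore] -/
theorem pairSignIte_ne_zero (j : NewFree Q F) :
    (if blockIdxSucc Q j.1 < blockIdxSucc Q (rep F j.1) then (1 : ℝ) else -1) ≠ 0 := by
  intro h
  have := abs_pairSignIte j
  rw [h, abs_zero] at this
  exact zero_ne_one this

/-- The signed basis difference of the (sorted) pair of labels of `j` is `e_{ι j} - e_{ι (rep F j)}`.
[folklore] -/
theorem smul_rsBasisDiff_pair (j : NewFree Q F) :
    (if blockIdxSucc Q j.1 < blockIdxSucc Q (rep F j.1) then (1 : ℝ) else -1) •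
      rsBasisDiff (if blockIdxSucc Q j.1 < blockIdxSucc Q (rep F j.1) then
        (blockIdxSucc Q j.1, blockIdxSucc Q (rep F j.1))
      else (blockIdxSucc Q (rep F j.1), blockIdxSucc Q j.1)) =
      Pi.single (blockIdxSucc Q j.1) (1 : ℝ) - Pi.single (blockIdxSucc Q (rep F j.1)) 1 := by
  split_ifs with h
  · rw [one_smul, rsBasisDiff]
  · rw [neg_one_smul, rsBasisDiff, neg_sub]

variable (hQ : Q ∈ Adm F)
include hQ

/-- `Q` refines `F`. [folklore] -/
theorem part_subset_of_mem_adm (a : Fin (k + 1)) : Q.part a ⊆ F.part a := ((mem_adm F).1 hQ).1 a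

/-- The blocks of an admissible `Q`: `C ∩ D` or `C ∖ D`, `D = demoted F Q`. [folklore] -/
theorem part_eq_of_mem_adm (a : Fin (k + 1)) :
    Q.part a = if a ∈ demoted F Q then F.part a ∩ demoted F Q else F.part a \ demoted F Q := by
  have := part_refineBy_eq F (A := demoted F Q) (F.part_mem.2 (mem_univ a))
    (F.mem_part_self.2 (mem_univ a))
  rwa [refineBy_demoted F hQ] at this

/-- `F`-representatives are not demoted. [folklore] -/
theorem rep_not_mem_demoted (a : Fin (k + 1)) : rep F a ∉ demoted F Q := by
  rw [mem_demoted, not_not, rep_rep]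
  exact isRep_of_isRep_of_subset F (part_subset_of_mem_adm hQ) (isRep_rep F a)

/-- Demoted elements are not `F`-representatives. [folklore] -/
theorem not_isRep_of_mem_demoted {y : Fin (k + 1)} (hy : y ∈ demoted F Q) : ¬IsRep F y := by
  intro h
  have := rep_not_mem_demoted hQ y
  rw [show rep F y = y from h] at this
  exact this hy

/-- The `Q`-representative of a demoted element is demoted. [folklore] -/
theorem rep_mem_demoted {x : Fin (k + 1)} (hx : x ∈ demoted F Q) : rep Q x ∈ demoted F Q := by
  have := rep_mem Q x
  rw [part_eq_of_mem_adm hQ, if_pos hx] at this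
  exact (Finset.mem_inter.1 this).2

/-- `rep F (rep Q x) = rep F x` (as `Q` refines `F`). [folklore] -/
theorem rep_rep_eq_rep (x : Fin (k + 1)) : rep F (rep Q x) = rep F x :=
  rep_eq_rep_of_mem F (part_subset_of_mem_adm hQ x (rep_mem Q x))

/-- The `Q`-block of a new free index `j` is `F.part j ∩ D`. [folklore] -/
theorem part_newFree (j : NewFree Q F) : Q.part j.1 = F.part j.1 ∩ demoted F Q := by
  rw [part_eq_of_mem_adm hQ, if_pos (mem_demoted_of_newFree j)]

/-- The `Q`-block of an `F`-representative is `F.part a ∖ D`. [folklore] -/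
theorem part_rep_eq_sdiff (a : Fin (k + 1)) : Q.part (rep F a) = F.part a \ demoted F Q := by
  rw [part_eq_of_mem_adm hQ, if_neg (rep_not_mem_demoted hQ a), part_rep]

/-- The label of a new free index differs from the label of any `F`-representative. [folklore] -/
theorem blockIdxSucc_newFree_ne (j : NewFree Q F) (a : Fin (k + 1)) :
    blockIdxSucc Q j.1 ≠ blockIdxSucc Q (rep F a) := by
  rw [Ne, blockIdxSucc_eq_iff_of_isRep j.2.1
    (isRep_of_isRep_of_subset F (part_subset_of_mem_adm hQ) (isRep_rep F a))]
  intro h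
  exact j.2.2 (h ▸ isRep_rep F a)

/-- The (sorted) pair of labels of a new free index `j` and of `rep F j` is a matched pair.
[cite: RudnickSarnak1996, proof of Prop 4.1] -/
theorem pair_mem_matchOf (j : NewFree Q F) :
    (if blockIdxSucc Q j.1 < blockIdxSucc Q (rep F j.1) then
        (blockIdxSucc Q j.1, blockIdxSucc Q (rep F j.1))
      else (blockIdxSucc Q (rep F j.1), blockIdxSucc Q j.1)) ∈
      matchOf Q (blockIdxSucc Q) F := by
  have hι : ∀ a b, blockIdxSucc Q a = blockIdxSucc Q b ↔ Q.part a = Q.part b :=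
    fun a b ↦ blockIdxSucc_eq_iff Q
  have hne := blockIdxSucc_newFree_ne hQ j j.1
  have hQne : Q.part j.1 ≠ Q.part (rep F j.1) := fun h ↦ hne ((hι _ _).2 h)
  rw [mem_matchOf]
  split_ifs with h
  · exact ⟨h, j.1, rep F j.1, rfl, rfl, (part_rep F j.1).symm, hQne⟩
  · exact ⟨lt_of_le_of_ne (not_lt.1 h) (Ne.symm hne), rep F j.1, j.1, rfl, rfl, part_rep F j.1,
      fun h' ↦ hQne h'.symm⟩

/-- Distinct new free indices have distinct pairs. [folklore] -/
theorem pair_injective : Function.Injective fun j : NewFree Q F ↦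
    (if blockIdxSucc Q j.1 < blockIdxSucc Q (rep F j.1) then (blockIdxSucc Q j.1, blockIdxSucc Q (rep F j.1)) else (blockIdxSucc Q (rep F j.1), blockIdxSucc Q j.1)) := by
  intro j₁ j₂ h
  have key : blockIdxSucc Q j₁.1 = blockIdxSucc Q j₂.1 → j₁ = j₂ := fun h' ↦
    Subtype.ext ((blockIdxSucc_eq_iff_of_isRep j₁.2.1 j₂.2.1).1 h')
  dsimp only at h
  split_ifs at h with h₁ h₂ h₂
  · exact key (Prod.mk.inj h).1
  · exact absurd (Prod.mk.inj h).1 (blockIdxSucc_newFree_ne hQ j₁ j₂.1)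
  · exact absurd (Prod.mk.inj h).2 (blockIdxSucc_newFree_ne hQ j₁ j₂.1)
  · exact key (Prod.mk.inj h).2

/-- Every matched pair is the pair of a new free index (the `Q`-representative of the demoted
witness). [cite: RudnickSarnak1996, proof of Prop 4.1] -/
theorem pair_surjective {p : Fin (#Q.parts - 1 + 1) × Fin (#Q.parts - 1 + 1)}
    (hp : p ∈ matchOf Q (blockIdxSucc Q) F) : ∃ j : NewFree Q F,
    (if blockIdxSucc Q j.1 < blockIdxSucc Q (rep F j.1) then (blockIdxSucc Q j.1, blockIdxSucc Q (rep F j.1)) else (blockIdxSucc Q (rep F j.1), blockIdxSucc Q j.1)) = p := by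
  have hι : ∀ a b, blockIdxSucc Q a = blockIdxSucc Q b ↔ Q.part a = Q.part b :=
    fun a b ↦ blockIdxSucc_eq_iff Q
  obtain ⟨hlt, a, b, ha, hb, hF, hQne⟩ := (mem_matchOf Q _).1 hp
  have hpa := part_eq_of_mem_adm hQ a
  have hpb := part_eq_of_mem_adm hQ b
  rw [← hF] at hpb
  by_cases haD : a ∈ demoted F Q <;> by_cases hbD : b ∈ demoted F Q
  · rw [if_pos haD] at hpa
    rw [if_pos hbD] at hpb
    exact absurd (hpa.trans hpb.symm) hQne
  · -- `a` demoted, `b` not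
    refine ⟨⟨rep Q a, isRep_rep Q a, not_isRep_of_mem_demoted hQ (rep_mem_demoted hQ haD)⟩, ?_⟩
    have h3 : blockIdxSucc Q (rep F a) = blockIdxSucc Q b := by
      rw [hι, part_rep_eq_sdiff hQ a, hpb, if_neg hbD]
    dsimp only
    rw [blockIdxSucc_rep, rep_rep_eq_rep hQ, h3, ha, hb, if_pos hlt]
  · -- `b` demoted, `a` not
    refine ⟨⟨rep Q b, isRep_rep Q b, not_isRep_of_mem_demoted hQ (rep_mem_demoted hQ hbD)⟩, ?_⟩
    have h3 : blockIdxSucc Q (rep F b) = blockIdxSucc Q a := by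
      rw [hι, part_rep_eq_sdiff hQ b, ← hF, hpa, if_neg haD]
    dsimp only
    rw [blockIdxSucc_rep, rep_rep_eq_rep hQ, h3, ha, hb, if_neg (not_lt.2 hlt.le)]
  · rw [if_neg haD] at hpa
    rw [if_neg hbD] at hpb
    exact absurd (hpa.trans hpb.symm) hQne

/-- `ζ(t)` at the label of a new free index `j₀` is `t_{j₀}`. [cite: RudnickSarnak1996, (4.13)] -/
theorem zeta_apply_label_newFree (t : NewFree Q F → ℝ) (j₀ : NewFree Q F) :
    ((∑ j : NewFree Q F, t j • (Pi.single (blockIdxSucc Q j.1) (1 : ℝ) -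
        Pi.single (blockIdxSucc Q (rep F j.1)) 1) : Fin (#Q.parts - 1 + 1) → ℝ))
        (blockIdxSucc Q j₀.1) = t j₀ := by
  rw [Finset.sum_apply]
  simp only [Pi.smul_apply, Pi.sub_apply, Pi.single_apply, smul_eq_mul]
  have : ∀ j : NewFree Q F,
      t j * ((if blockIdxSucc Q j₀.1 = blockIdxSucc Q j.1 then (1 : ℝ) else 0) -
        (if blockIdxSucc Q j₀.1 = blockIdxSucc Q (rep F j.1) then (1 : ℝ) else 0)) =
        if j₀ = j then t j else 0 := by
    intro j
    rw [if_neg (blockIdxSucc_newFree_ne hQ j₀ j.1), sub_zero]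
    by_cases h : j₀ = j
    · subst h
      simp
    · rw [if_neg h, if_neg (fun h' ↦ h (Subtype.ext ((blockIdxSucc_eq_iff_of_isRep j₀.2.1 j.2.1).1 h'))),
        mul_zero]
  rw [Finset.sum_congr rfl (fun j _ ↦ this j), Finset.sum_ite_eq]
  simp

omit hQ in
/-- Summing an indicator of "same label as `i`" over the `Q`-representatives of an `F`-block
detects whether `i` lies in the block (`i` a `Q`-representative). [folklore] -/
theorem sum_filter_isRep_ite_label_eq (a : Fin (k + 1)) {i : Fin (k + 1)} (hi : IsRep Q i) (c : ℝ) :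
    ∑ q ∈ (F.part a).filter (IsRep Q), (if blockIdxSucc Q q = blockIdxSucc Q i then c else 0) =
      if i ∈ F.part a then c else 0 := by
  have : ∀ q ∈ (F.part a).filter (IsRep Q),
      (if blockIdxSucc Q q = blockIdxSucc Q i then c else 0) = if q = i then c else 0 := by
    intro q hq
    by_cases h : q = i
    · subst h
      simp
    · rw [if_neg h, if_neg ((blockIdxSucc_eq_iff_of_isRep (Finset.mem_filter.1 hq).2 hi).not.2 h)]
  rw [Finset.sum_congr rfl this, Finset.sum_ite_eq']
  simp only [Finset.mem_filter, hi, and_true]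

/-- **The `F`-block sums of the fibre point over `ζ(t)` vanish.** [cite: RudnickSarnak1996, (4.13)] -/
theorem sum_part_fillQ_zeta (t : NewFree Q F → ℝ) (w : Free Q → ℝ) (a : Fin (k + 1)) :
    ∑ i ∈ F.part a, fillQ Q (blockIdxSucc Q)
      ((∑ j : NewFree Q F, t j • (Pi.single (blockIdxSucc Q j.1) (1 : ℝ) -
        Pi.single (blockIdxSucc Q (rep F j.1)) 1) : Fin (#Q.parts - 1 + 1) → ℝ)) w i = 0 := by
  have hι : ∀ a b, blockIdxSucc Q a = blockIdxSucc Q b ↔ Q.part a = Q.part b :=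
    fun a b ↦ blockIdxSucc_eq_iff Q
  have hQF := part_subset_of_mem_adm hQ
  rw [sum_part_eq_sum_filter_isRep hQF _ a]
  simp_rw [sum_part_fillQ Q _ hι]
  simp only [Finset.sum_apply, Pi.smul_apply, Pi.sub_apply, Pi.single_apply, smul_eq_mul]
  rw [Finset.sum_comm]
  refine Finset.sum_eq_zero fun j _ ↦ ?_
  rw [← Finset.mul_sum, Finset.sum_sub_distrib, sum_filter_isRep_ite_label_eq a j.2.1,
    sum_filter_isRep_ite_label_eq a (isRep_of_isRep_of_subset F hQF (isRep_rep F j.1))]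
  have hiff : j.1 ∈ F.part a ↔ rep F j.1 ∈ F.part a := by
    rw [mem_part_iff_part_eq F, mem_part_iff_part_eq F, part_rep]
  by_cases h : j.1 ∈ F.part a
  · rw [if_pos h, if_pos (hiff.1 h), sub_self, mul_zero]
  · rw [if_neg h, if_neg (fun h' ↦ h (hiff.2 h')), sub_self, mul_zero]

/-- **The fibre point over `ζ(t)` is the glued point**: `fillQ Q ι ζ(t) w = extG F (glue Q F t w)`.
[cite: RudnickSarnak1996, (4.13)–(4.14)] -/
theorem fillQ_zeta_eq_extG_glue (t : NewFree Q F → ℝ) (w : Free Q → ℝ) :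
    fillQ Q (blockIdxSucc Q)
      ((∑ j : NewFree Q F, t j • (Pi.single (blockIdxSucc Q j.1) (1 : ℝ) -
        Pi.single (blockIdxSucc Q (rep F j.1)) 1) : Fin (#Q.parts - 1 + 1) → ℝ)) w =
      extG F (glue Q F t w) := by
  have h1 : (fun i : Free F ↦ fillQ Q (blockIdxSucc Q)
      ((∑ j : NewFree Q F, t j • (Pi.single (blockIdxSucc Q j.1) (1 : ℝ) -
        Pi.single (blockIdxSucc Q (rep F j.1)) 1) : Fin (#Q.parts - 1 + 1) → ℝ)) w i) =
      glue Q F t w := by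
    funext j
    unfold glue
    by_cases h : IsRep Q j.1
    · rw [dif_pos h, fillQ_apply_of_isRep Q _ _ _ h, zeta_apply_label_newFree hQ t ⟨j.1, h, j.2⟩,
        freeSum]
    · rw [dif_neg h, fillQ_apply_of_not_isRep Q _ _ _ h]
  rw [← h1]
  exact (extG_eq_of_sum_part_eq_zero F _ (sum_part_fillQ_zeta hQ t w)).symm

/-- The new block sums of the glued point as a product over the blocks of `F` meeting `D`:
`∏_{C ∩ D ≠ ∅} |u_{C ∩ D}| = ∏_j |t_j|` at `u = extG F (glue Q F t w)`. [cite: RudnickSarnak1996, (4.13)] -/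
theorem prod_filter_abs_sum_inter_eq (t : NewFree Q F → ℝ) (w : Free Q → ℝ) :
    ∏ C ∈ F.parts with (C ∩ demoted F Q).Nonempty,
        |∑ i ∈ C ∩ demoted F Q, extG F (glue Q F t w) i| = ∏ j, |t j| := by
  have hQF := part_subset_of_mem_adm hQ
  symm
  refine Finset.prod_bij' (fun j _ ↦ F.part j.1)
    (fun C hC ↦ ⟨rep Q (Finset.mem_filter.1 hC).2.choose, isRep_rep Q _,
      not_isRep_of_mem_demoted hQ (rep_mem_demoted hQ
        (Finset.mem_inter.1 (Finset.mem_filter.1 hC).2.choose_spec).2)⟩) ?_ ?_ ?_ ?_ ?_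
  · intro j _
    exact Finset.mem_filter.2 ⟨F.part_mem.2 (mem_univ _),
      ⟨j.1, Finset.mem_inter.2 ⟨F.mem_part_self.2 (mem_univ _), mem_demoted_of_newFree j⟩⟩⟩
  · intro C _
    exact mem_univ _
  · intro j _
    set hne := (Finset.mem_filter.1 (Finset.mem_filter.2 ⟨F.part_mem.2 (mem_univ _),
      ⟨j.1, Finset.mem_inter.2 ⟨F.mem_part_self.2 (mem_univ _), mem_demoted_of_newFree j⟩⟩⟩ :
        F.part j.1 ∈ F.parts.filter fun C ↦ (C ∩ demoted F Q).Nonempty)).2 with hne_def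
    obtain ⟨hxC, hxD⟩ := Finset.mem_inter.1 hne.choose_spec
    apply Subtype.ext
    change rep Q hne.choose = j.1
    have hpart : Q.part hne.choose = Q.part j.1 := by
      rw [part_eq_of_mem_adm hQ, if_pos hxD, F.part_eq_of_mem (F.part_mem.2 (mem_univ _)) hxC,
        part_newFree hQ j]
    rw [(part_eq_part_iff_rep_eq Q).1 hpart]
    exact j.2.1
  · intro C hC
    obtain ⟨hCp, hne⟩ := Finset.mem_filter.1 hC
    obtain ⟨hxC, hxD⟩ := Finset.mem_inter.1 hne.choose_spec
    change F.part (rep Q hne.choose) = C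
    have h1 : rep Q hne.choose ∈ F.part hne.choose := hQF _ (rep_mem Q _)
    rw [F.part_eq_of_mem hCp hxC] at h1
    exact F.part_eq_of_mem hCp h1
  · intro j _
    rw [← part_newFree hQ j, sum_part_extG_glue_of_newFree Q F hQF t w j]

/-- **The pair term over `H_F`** (RS Lemma 4.1, (4.13)–(4.14)): for `Q ∈ Adm F` and continuous
compactly supported `Φ`,
`∫ ∏_p |v_p| Φ_Q(∑_p v_p e_p) dv = ∫ ∏_{C ∩ D ≠ ∅} |u_{C ∩ D}| Φ(u) du` over `u = extG F u' ∈ H_F`,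
`D = demoted F Q`. The substitution `v_p = ± t_j` (`p` the pair of the new free index `j`) is a
reindexing followed by sign changes, hence preserves Lebesgue measure; then the fibres of `Q` are
glued over the new block sums `t`. [cite: RudnickSarnak1996, Lemma 4.1 and (4.13)] -/
theorem pairTerm_eq_integral_extG {Φ : (Fin (k + 1) → ℝ) → ℂ} (hΦc : Continuous Φ)
    (hΦs : HasCompactSupport Φ) :
    (∫ v : (matchOf Q (blockIdxSucc Q) F) → ℝ, ((∏ p, |v p| : ℝ) : ℂ) *
        fibreIntegral Q (blockIdxSucc Q) Φ
          (∑ p, v p • rsBasisDiff (p : Fin (#Q.parts - 1 + 1) × Fin (#Q.parts - 1 + 1)))) =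
      ∫ u' : Free F → ℝ, ((∏ C ∈ F.parts with (C ∩ demoted F Q).Nonempty,
        |∑ i ∈ C ∩ demoted F Q, extG F u' i| : ℝ) : ℂ) * Φ (extG F u') := by
  have hQF := part_subset_of_mem_adm hQ
  -- the bijection `NewFree Q F ≃ matchOf Q ι F`
  obtain ⟨e, he⟩ : ∃ e : NewFree Q F ≃ matchOf Q (blockIdxSucc Q) F, ∀ j,
      ((e j : matchOf Q (blockIdxSucc Q) F) : Fin (#Q.parts - 1 + 1) × Fin (#Q.parts - 1 + 1)) =
        (if blockIdxSucc Q j.1 < blockIdxSucc Q (rep F j.1) then (blockIdxSucc Q j.1, blockIdxSucc Q (rep F j.1)) else (blockIdxSucc Q (rep F j.1), blockIdxSucc Q j.1)) :=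
    ⟨Equiv.ofBijective (fun j ↦ ⟨_, pair_mem_matchOf hQ j⟩)
      ⟨fun j₁ j₂ h ↦ pair_injective hQ (congrArg Subtype.val h), fun p ↦ by
        obtain ⟨j, hj⟩ := pair_surjective hQ p.2
        exact ⟨j, Subtype.ext hj⟩⟩, fun j ↦ rfl⟩
  -- the substitution `v_p = ± t_j`
  obtain ⟨T, hTapp⟩ : ∃ T : (NewFree Q F → ℝ) ≃ᵐ ((matchOf Q (blockIdxSucc Q) F) → ℝ), ∀ t p,
      T t p = (if blockIdxSucc Q (e.symm p).1 < blockIdxSucc Q (rep F (e.symm p).1) then (1 : ℝ) else -1) *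
        t (e.symm p) := by
    refine ⟨(MeasurableEquiv.piCongrLeft (fun _ ↦ ℝ) e).trans (MeasurableEquiv.piCongrRight fun p ↦
      MeasurableEquiv.mulLeft₀
        (if blockIdxSucc Q (e.symm p).1 < blockIdxSucc Q (rep F (e.symm p).1) then (1 : ℝ) else -1)
        (pairSignIte_ne_zero _)), fun t p ↦ ?_⟩
    have happ := MeasurableEquiv.piCongrLeft_apply_apply e (β := fun _ ↦ ℝ) t (e.symm p)
    rw [Equiv.apply_symm_apply] at happ
    rw [← happ]
    rfl
  have hT : MeasurePreserving T volume volume := by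
    have h1 := volume_measurePreserving_piCongrLeft (fun _ : matchOf Q (blockIdxSucc Q) F ↦ ℝ) e
    have h2 : MeasurePreserving (fun (v : matchOf Q (blockIdxSucc Q) F → ℝ) p ↦
        (if blockIdxSucc Q (e.symm p).1 < blockIdxSucc Q (rep F (e.symm p).1) then (1 : ℝ) else -1) * v p)
        volume volume := by
      refine volume_preserving_pi (fun p ↦ ⟨measurable_const_mul _, ?_⟩)
      rw [Real.map_volume_mul_left (pairSignIte_ne_zero _), abs_inv, abs_pairSignIte, inv_one,
        ENNReal.ofReal_one, one_smul]
    have hcomp : ⇑T = (fun (v : matchOf Q (blockIdxSucc Q) F → ℝ) p ↦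
        (if blockIdxSucc Q (e.symm p).1 < blockIdxSucc Q (rep F (e.symm p).1) then (1 : ℝ) else -1) * v p) ∘
          (MeasurableEquiv.piCongrLeft (fun _ ↦ ℝ) e) := by
      funext t
      funext p
      rw [Function.comp_apply, hTapp]
      congr 1
      have happ := MeasurableEquiv.piCongrLeft_apply_apply e (β := fun _ ↦ ℝ) t (e.symm p)
      rw [Equiv.apply_symm_apply] at happ
      exact happ.symm
    rw [hcomp]
    exact h2.comp h1
  rw [← hT.integral_comp']
  have hfun : (fun t : NewFree Q F → ℝ ↦ ((∏ p, |T t p| : ℝ) : ℂ) *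
      fibreIntegral Q (blockIdxSucc Q) Φ (∑ p, T t p •
        rsBasisDiff (p : Fin (#Q.parts - 1 + 1) × Fin (#Q.parts - 1 + 1)))) =
      fun t ↦ ∫ w : Free Q → ℝ, ((∏ j, |t j| : ℝ) : ℂ) * Φ (extG F (glue Q F t w)) := by
    funext t
    have hprod : ∏ p, |T t p| = ∏ j, |t j| := by
      refine Fintype.prod_equiv e.symm _ _ fun p ↦ ?_
      rw [hTapp, abs_mul, abs_pairSignIte, one_mul]
    have hzeta : ∑ p, T t p • rsBasisDiff (p : Fin (#Q.parts - 1 + 1) × Fin (#Q.parts - 1 + 1)) =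
        ((∑ j : NewFree Q F, t j • (Pi.single (blockIdxSucc Q j.1) (1 : ℝ) -
        Pi.single (blockIdxSucc Q (rep F j.1)) 1) : Fin (#Q.parts - 1 + 1) → ℝ)) := by
      rw [← Equiv.sum_comp e]
      refine Finset.sum_congr rfl fun j _ ↦ ?_
      rw [hTapp, Equiv.symm_apply_apply, he, mul_comm, mul_smul, smul_rsBasisDiff_pair]
    rw [hprod, hzeta, fibreIntegral, ← integral_const_mul]
    refine integral_congr_ae (Filter.Eventually.of_forall fun w ↦ ?_)
    beta_reduce
    rw [fillQ_zeta_eq_extG_glue hQ]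
  rw [hfun]
  have hint : Integrable fun u' : Free F → ℝ ↦
      ((∏ C ∈ F.parts with (C ∩ demoted F Q).Nonempty,
        |∑ i ∈ C ∩ demoted F Q, extG F u' i| : ℝ) : ℂ) * Φ (extG F u') := by
    refine integrable_weight_mul_testfn_comp_extG F hΦc hΦs ?_
    exact Complex.continuous_ofReal.comp (continuous_finsetProd _ fun C _ ↦
      (continuous_abs.comp (continuous_finsetSum _ fun i _ ↦
        (continuous_apply i).comp (continuous_extG F))))
  refine Eq.trans ?_ (integral_extG_eq_integral_integral_glue Q F hQF
    (F := fun u ↦ ((∏ C ∈ F.parts with (C ∩ demoted F Q).Nonempty,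
      |∑ i ∈ C ∩ demoted F Q, u i| : ℝ) : ℂ) * Φ u) hint).symm
  refine integral_congr_ae (Filter.Eventually.of_forall fun t ↦ ?_)
  refine integral_congr_ae (Filter.Eventually.of_forall fun w ↦ ?_)
  dsimp only
  rw [prod_filter_abs_sum_inter_eq hQ t w]

end key

/-! ## Theorem 4.1 -/

/-- **Rudnick–Sarnak Theorem 4.1, discharged** (`Ŵ_n = R_O` on `∑ |u_j| < 2`, paired with an
admissible `Φ`): for admissible `Φ` with `f_Φ` a test function and any admissible
representatives `Φ'_Q` of the pull-backs `ι_Q^* f_Φ`,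
`∑_Q μ(O, Q) ∫ Φ'_Q C_O^{(ν(Q))} = ∫ f_Φ(x) W_{k+1}(x) δ(x̄) dx`. Proof: both sides equal
`∑_F ∑_{A ⊆ free(F)} μ(O, F_A) ∫_{H_F} ∏_{C ∩ A ≠ ∅} |u_{C∩A}| Φ(u) du` — the arithmetic side by
(4.14) (representative independence and fibre integrals), the marking/coarsening bijection of
Proposition 4.1 and the gluing of strata (Lemma 4.1); the GUE side by the determinant
expansion (4.27), Lemmas 4.2–4.3, Proposition 4.3 per cycle (Spitzer's identity) and the
factorisation (4.25) with (4.4). [cite: RudnickSarnak1996, Thm 4.1, Props 4.1–4.3] -/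
theorem _root_.Literature.NumberTheory.LFunctions.rudnick_sarnak_thm41_holds : rudnick_sarnak_thm41 := by
  intro k _ Φ hΦ hTF Φ' hadm heq
  rw [sum_partitionMoebius_mul_rsPairingFunctional_eq hΦ hTF Φ' hadm heq,
    rsLimit_eq_sum_sum_powerset hΦ hTF.schwartz_slice]
  refine Finset.sum_congr rfl fun F _ ↦ Finset.sum_congr rfl fun A hA ↦ ?_
  have hA' : A ⊆ freeSet F := Finset.mem_powerset.1 hA
  rw [pairTerm_eq_integral_extG (refineBy_mem_adm F A) hΦ.contDiff.continuous hΦ.hasCompactSupport,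
    demoted_refineBy F hA']

end RudnickSarnak

end Literature.NumberTheory.LFunctions

end
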